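import Summits.QuantumFields.BalabanUV.Beta.SecondOrderStepLaw
import Summits.QuantumFields.BalabanUV.Beta.DiagonalContactLoc

/-!
# `BalabanUV.Beta.SecondOrderZeroCanon` — binder row D1, (L4) piece (W-E): **THE LEVEL-`0` ASSEMBLY WITH THE CANONICAL SECOND SYMBOL
# `X₂ := X∘X′` AND AN `ff`-ENTRYWISE WILSON LAW** (`quarticZero_bref_of_ffLaw`), and the classes of the canonical symbol
# `p c ↦ c₂ · ctGen κ u p c · ctGen κ′ u′ p c` (β sub-cell, row BETA-an2 = BINDER-OWNERS row D1 OWNER, lineage an2 gen 19)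

HONEST FRAMING (cell charter, verbatim): «discharging BetaPertH makes Balaban's UV stability UNCONDITIONAL — a real
constructive-QFT result; it is NOT the continuum limit and NOT the Clay problem.»  Neutral kernel algebra ([folklore]), entrywise by fibre
blocks; no statement of Bałaban's papers, no `[cite:]`, no `def`, no `Prop` fact; instantiates no binder of the wall.  NOT D1, NOT `BetaPertH`,
NOT continuum, NOT Clay.

WHAT.  `SecondOrderZeroLaw.quarticZero_bref_of_laws` needs the Wilson (field–field) sector's Hessian `P` as a SEPARATE field-supported kernel
and carries two free second symbols `hh` (Wilson) / `hB` (border) whose mismatch enters the remainder as `conjV P (diagK (a·hh − w·hB))`.  With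
the CANONICAL second symbols `X₂ := X∘X′` on both sectors — field sector `κ₁²·ĝ·ĝ′`, border sector `γ′²·ĝ·ĝ′`, `ĝ := ctGen d α L κ u`,
`ĝ′ := ctGen d α L κ′ u′` — the two symbols AGREE under the locks `γ′ = aE·κ₁`, `a = aE²` (unit field weight, the level-`0` situation
`𝕄₀ = bhKAt`), the mismatch term VANISHES IDENTICALLY, and the Wilson law may be stated `ff`-ENTRYWISE against the FULL bordered kernel `𝕄`
(its field–field block is all that the `ff` entries of `conjW 𝕄 …` with diagonal generators see) — no separate `P` is needed:
* §1 **`quarticZero_bref_of_ffLaw`**: from (hQff) the `ff`-entrywise law of the field sector `Q` with letters `E`, coefficient `κ₁`, canonical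
  second symbol and a free field-supported residual `R₀`, and (hBfm/hBmf/hBmm) the border letter of `B` with letters `aE • E + Vbd`, coefficient
  `γ′`, canonical second symbol and a free residual `RB` vanishing on the field block, conclude the law of `T := a • Q + b • B` in `conjW` form
  with remainder `a • R₀ + RB` (nothing else).
* §2 the CLASSES of the canonical symbol: `abs_ctGen_mul_ctGen_le` (bounded by `|c|·(1 + ell)²`) and **`locStencil₂_diagK_ctGen_mul_ctGen`**
  (`κ u κ′ u′ ↦ diagK (c·ĝ·ĝ′)` is a `LocStencil₂` family at every rate `δ ≥ 0`) — the binders `hhb` / `hhl` of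
  `SpineRooted.…_JsRecWAtOf_of_letters_closed` for the canonical `h`.
READING (wall, level `0`): `𝕄 := bhKStepAt 3 ρ_c Lc 0 = bhKAt`, `Q := wilsonW₂ 3 T`, `E := wilsonA 3`, `aE := cE = Lc⁴`, `Vbd := cVH • vhSAt ρ_c`,
`B := vh₂S`, `b := cB`, `a := cE₂`, `κ₁ := κ_W = −½` (an3's `wilsonA_bref`), `γ′ := γ₀ = cE·κ_W = −Lc⁴/2`, lock `cE₂ = cE² = Lc⁸`.  The Wilson
letter (hQff) is then the PARAMETER-FREE even-part identity of the owner's journal line (CLAIMS l.12363 (A2)) plus an odd field-supported slot `R₀`.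
Provenance: β sub-cell, unit beta-an2 gen 19, 2026-08-20 (v1); no existing file touched.
-/

open Finset
open scoped BigOperators
open Literature.MathematicalPhysics.QuantumFieldTheory
open Literature.MathematicalPhysics.QuantumFieldTheory.Balaban1983to89
open Literature.MathematicalPhysics.QuantumFieldTheory.Balaban1983to89.Beta
open B12Sec2to5 (l1 l1_nonneg)
open ExpKernelCalculus (MKer BiLoc)
open AveragingHessianKernels (ell)
open PolarizationSign (reflSign)
open KernelReflection (refK refK_apply)
open ResolventReflection (bref Φ)
open OneStepResolventKernel (Fib)
open BalabanCompositeJets (LocStencil₂)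
open Summit.QuantumFields.BalabanUV.Beta.TameKernelCalculus
open Summit.QuantumFields.BalabanUV.Beta.ChartConjugation (conjV conjW conjW₁ conjW₂)
open Summit.QuantumFields.BalabanUV.Beta.BorderedHessian (diagK diagK_apply ctGen conjV_diagK_apply abs_ctGen_le ctGen_eq_zero_of_not_mem_cube)
open Summit.QuantumFields.BalabanUV.Beta.SecondOrderStepLaw (conjW_diag_apply)
open Summit.QuantumFields.BalabanUV.Beta.AxialDressingRooted (cube mem_cube l1_le_of_mem_cube)

namespace Summit.QuantumFields.BalabanUV.Beta.SecondOrderZeroCanon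

noncomputable section

variable {d : ℕ}

/-! ## §1 The level-generic assembly with canonical second symbols and an `ff`-entrywise field-sector law -/

section Zero

variable {L : ℕ} {𝕄 : MKer (d + 1) (Fib d)} {a aE b κ₁ γ' : ℝ} {α : Fin (d + 1)}
  {Q R₀ B RB : Fin (d + 1) → (Fin (d + 1) → ℤ) → Fin (d + 1) → (Fin (d + 1) → ℤ) → MKer (d + 1) (Fib d)}
  {E Vbd : Fin (d + 1) → (Fin (d + 1) → ℤ) → MKer (d + 1) (Fib d)}

/-- [folklore] **THE ASSEMBLY WITH CANONICAL SECOND SYMBOLS AND AN `ff`-ENTRYWISE FIELD-SECTOR LAW** (see the module docstring).  The field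
sector `Q`, its letters `E` and its residual `R₀` are supported on the field block (`hQ*`/`hE*`/`hR*`); the border sector `B`, its residual `RB`
and the border letters `Vbd` vanish on the field block; the locks are `γ′ = aE·κ₁`, `a = aE²` (unit field weight). -/
theorem quarticZero_bref_of_ffLaw (hγ' : γ' = aE * κ₁) (ha : a = aE ^ 2)
    (hQl : ∀ κ u κ' u' (x z : Fin (d + 1) → ℤ) (m : Fin (d + 1)) (b' : Fib d), Q κ u κ' u' x z (Sum.inr m) b' = 0)
    (hQr : ∀ κ u κ' u' (x z : Fin (d + 1) → ℤ) (a' : Fib d) (m : Fin (d + 1)), Q κ u κ' u' x z a' (Sum.inr m) = 0)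
    (hEl : ∀ κ u (x z : Fin (d + 1) → ℤ) (m : Fin (d + 1)) (b' : Fib d), E κ u x z (Sum.inr m) b' = 0)
    (hEr : ∀ κ u (x z : Fin (d + 1) → ℤ) (a' : Fib d) (m : Fin (d + 1)), E κ u x z a' (Sum.inr m) = 0)
    (hRl : ∀ κ u κ' u' (x z : Fin (d + 1) → ℤ) (m : Fin (d + 1)) (b' : Fib d), R₀ κ u κ' u' x z (Sum.inr m) b' = 0)
    (hRr : ∀ κ u κ' u' (x z : Fin (d + 1) → ℤ) (a' : Fib d) (m : Fin (d + 1)), R₀ κ u κ' u' x z a' (Sum.inr m) = 0)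
    (hBff : ∀ κ u κ' u' (x z : Fin (d + 1) → ℤ) (β β' : Fin (d + 1)), B κ u κ' u' x z (Sum.inl β) (Sum.inl β') = 0)
    (hRBff : ∀ κ u κ' u' (x z : Fin (d + 1) → ℤ) (β β' : Fin (d + 1)), RB κ u κ' u' x z (Sum.inl β) (Sum.inl β') = 0)
    (hVff : ∀ κ u (x z : Fin (d + 1) → ℤ) (β β' : Fin (d + 1)), Vbd κ u x z (Sum.inl β) (Sum.inl β') = 0)
    (hQff : ∀ κ u κ' u' (x z : Fin (d + 1) → ℤ) (β β' : Fin (d + 1)),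
      Q κ (bref α κ u) κ' (bref α κ' u') x z (Sum.inl β) (Sum.inl β') =
        ((reflSign α κ * reflSign α κ') • refK (Φ (d := d) L α)
          (Q κ u κ' u' +
            conjW 𝕄 (E κ u) (E κ' u') (diagK fun p c => κ₁ * ctGen d α L κ u p c) (diagK fun p c => κ₁ * ctGen d α L κ' u' p c)
              (diagK fun p c => κ₁ ^ 2 * (ctGen d α L κ u p c * ctGen d α L κ' u' p c)) + R₀ κ u κ' u')) x z (Sum.inl β) (Sum.inl β'))
    (hBfm : ∀ κ u κ' u' (x z : Fin (d + 1) → ℤ) (β m : Fin (d + 1)),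
      (b • B κ (bref α κ u) κ' (bref α κ' u')) x z (Sum.inl β) (Sum.inr m) =
        ((reflSign α κ * reflSign α κ') • refK (Φ (d := d) L α) (b • B κ u κ' u' +
          conjW 𝕄 (aE • E κ u + Vbd κ u) (aE • E κ' u' + Vbd κ' u') (diagK fun p c => γ' * ctGen d α L κ u p c)
            (diagK fun p c => γ' * ctGen d α L κ' u' p c) (diagK fun p c => γ' ^ 2 * (ctGen d α L κ u p c * ctGen d α L κ' u' p c)) +
          RB κ u κ' u')) x z (Sum.inl β) (Sum.inr m))
    (hBmf : ∀ κ u κ' u' (x z : Fin (d + 1) → ℤ) (m β : Fin (d + 1)),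
      (b • B κ (bref α κ u) κ' (bref α κ' u')) x z (Sum.inr m) (Sum.inl β) =
        ((reflSign α κ * reflSign α κ') • refK (Φ (d := d) L α) (b • B κ u κ' u' +
          conjW 𝕄 (aE • E κ u + Vbd κ u) (aE • E κ' u' + Vbd κ' u') (diagK fun p c => γ' * ctGen d α L κ u p c)
            (diagK fun p c => γ' * ctGen d α L κ' u' p c) (diagK fun p c => γ' ^ 2 * (ctGen d α L κ u p c * ctGen d α L κ' u' p c)) +
          RB κ u κ' u')) x z (Sum.inr m) (Sum.inl β))
    (hBmm : ∀ κ u κ' u' (x z : Fin (d + 1) → ℤ) (m m' : Fin (d + 1)),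
      (b • B κ (bref α κ u) κ' (bref α κ' u')) x z (Sum.inr m) (Sum.inr m') =
        ((reflSign α κ * reflSign α κ') • refK (Φ (d := d) L α) (b • B κ u κ' u' +
          conjW 𝕄 (aE • E κ u + Vbd κ u) (aE • E κ' u' + Vbd κ' u') (diagK fun p c => γ' * ctGen d α L κ u p c)
            (diagK fun p c => γ' * ctGen d α L κ' u' p c) (diagK fun p c => γ' ^ 2 * (ctGen d α L κ u p c * ctGen d α L κ' u' p c)) +
          RB κ u κ' u')) x z (Sum.inr m) (Sum.inr m'))
    (κ : Fin (d + 1)) (u : Fin (d + 1) → ℤ) (κ' : Fin (d + 1)) (u' : Fin (d + 1) → ℤ) :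
    a • Q κ (bref α κ u) κ' (bref α κ' u') + b • B κ (bref α κ u) κ' (bref α κ' u') =
      (reflSign α κ * reflSign α κ') • refK (Φ (d := d) L α)
        ((a • Q κ u κ' u' + b • B κ u κ' u') +
          conjW 𝕄 (aE • E κ u + Vbd κ u) (aE • E κ' u' + Vbd κ' u') (diagK fun p c => γ' * ctGen d α L κ u p c)
            (diagK fun p c => γ' * ctGen d α L κ' u' p c) (diagK fun p c => γ' ^ 2 * (ctGen d α L κ u p c * ctGen d α L κ' u' p c)) +
          (a • R₀ κ u κ' u' + RB κ u κ' u')) := by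
  subst hγ' ha
  funext x z e f
  rcases e with β | m <;> rcases f with β' | m'
  · -- field–field: the `Q` sector carries the contact; `B`, `Vbd`, `RB` vanish; the locks match the coefficients EXACTLY (canonical symbols)
    have hq := hQff κ u κ' u' x z β β'
    simp only [Pi.add_apply, Pi.smul_apply, smul_eq_mul, refK_apply, conjW_diag_apply, hBff, hRBff, hVff] at hq ⊢
    rw [hq]
    ring
  · -- field–multiplier: the border letter; `Q`, `R₀`, `E` vanish on this block
    have hb := hBfm κ u κ' u' x z β m'
    simp only [Pi.add_apply, Pi.smul_apply, smul_eq_mul, refK_apply, conjW_diag_apply, hQr, hEr, hRr, mul_zero, zero_add] at hb ⊢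
    rw [hb]
  · have hb := hBmf κ u κ' u' x z m β'
    simp only [Pi.add_apply, Pi.smul_apply, smul_eq_mul, refK_apply, conjW_diag_apply, hQl, hEl, hRl, mul_zero, zero_add] at hb ⊢
    rw [hb]
  · have hb := hBmm κ u κ' u' x z m m'
    simp only [Pi.add_apply, Pi.smul_apply, smul_eq_mul, refK_apply, conjW_diag_apply, hQl, hEl, hRl, mul_zero, zero_add] at hb ⊢
    rw [hb]

end Zero

/-! ## §2 The classes of the canonical second symbol -/

section Canon

variable (α : Fin (d + 1)) (L : ℕ) [NeZero L]

/-- [folklore] The canonical second symbol is bounded: `|c · ĝ p a · ĝ′ p a| ≤ |c| · (1 + ell (d+1) L)²`. -/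
theorem abs_ctGen_mul_ctGen_le (c : ℝ) (κ : Fin (d + 1)) (u : Fin (d + 1) → ℤ) (κ' : Fin (d + 1)) (u' : Fin (d + 1) → ℤ)
    (p : Fin (d + 1) → ℤ) (a : Fib d) :
    |c * (ctGen d α L κ u p a * ctGen d α L κ' u' p a)| ≤ |c| * (1 + ell (d + 1) L) ^ 2 := by
  rw [abs_mul, abs_mul, sq]
  exact mul_le_mul_of_nonneg_left (mul_le_mul (abs_ctGen_le α L κ u p a) (abs_ctGen_le α L κ' u' p a) (abs_nonneg _) (by positivity))
    (abs_nonneg c)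

/-- [folklore] **THE CANONICAL SECOND SYMBOL IS A `LocStencil₂` FAMILY** at every rate `δ ≥ 0`:
`LocStencil₂ (fun κ u κ′ u′ => diagK fun p a => c · ctGen κ u p a · ctGen κ′ u′ p a) (|c| · (1 + ell)² · e^{δ(d+1)·12L}) δ`
(finite range of both generators, `ctGen_eq_zero_of_not_mem_cube`, and the triangle inequality for the bond separation). -/
theorem locStencil₂_diagK_ctGen_mul_ctGen (c : ℝ) {δ : ℝ} (hδ : 0 ≤ δ) :
    LocStencil₂ (fun κ u κ' u' => diagK fun p a => c * (ctGen d α L κ u p a * ctGen d α L κ' u' p a))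
      (|c| * (1 + ell (d + 1) L) ^ 2 * Real.exp (δ * (((d : ℝ) + 1) * (12 * L)))) δ := by
  classical
  intro κ u κ' u' x y a b
  set C : ℝ := |c| * (1 + ell (d + 1) L) ^ 2 * Real.exp (δ * (((d : ℝ) + 1) * (12 * L))) with hC
  have hCnn : 0 ≤ C := by rw [hC]; positivity
  have hnn : 0 ≤ C * Real.exp (-δ * l1 (u' - u)) * Real.exp (-δ * (l1 (x - u) + l1 (y - u))) := by positivity
  show |diagK (fun p a => c * (ctGen d α L κ u p a * ctGen d α L κ' u' p a)) x y a b| ≤ _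
  rw [diagK_apply]
  split_ifs with h
  · obtain ⟨rfl, rfl⟩ := h
    by_cases hx : u - x ∈ cube (d + 1) (2 * L)
    · by_cases hx' : u' - x ∈ cube (d + 1) (2 * L)
      · have hl : l1 (x - u) ≤ ((d : ℝ) + 1) * (2 * L) := by
          rw [ExpKernelCalculus.l1_sub_symm]
          have := l1_le_of_mem_cube hx
          push_cast at this
          linarith
        have hl' : l1 (x - u') ≤ ((d : ℝ) + 1) * (2 * L) := by
          rw [ExpKernelCalculus.l1_sub_symm]
          have := l1_le_of_mem_cube hx'
          push_cast at this
          linarith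
        have hsep : l1 (u' - u) ≤ ((d : ℝ) + 1) * (4 * L) := by
          have htri : l1 (u' - u) ≤ l1 (u' - x) + l1 (x - u) := ExpKernelCalculus.l1_sub_triangle u' x u
          rw [ExpKernelCalculus.l1_sub_symm u' x] at htri
          linarith
        have h0 : 0 ≤ l1 (x - u) := l1_nonneg _
        have h1 : 0 ≤ l1 (u' - u) := l1_nonneg _
        calc |c * (ctGen d α L κ u x a * ctGen d α L κ' u' x a)| ≤ |c| * (1 + ell (d + 1) L) ^ 2 * 1 := by
              rw [mul_one]; exact abs_ctGen_mul_ctGen_le α L c κ u κ' u' x a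
          _ ≤ |c| * (1 + ell (d + 1) L) ^ 2 *
                (Real.exp (δ * (((d : ℝ) + 1) * (12 * L))) * (Real.exp (-δ * l1 (u' - u)) * Real.exp (-δ * (l1 (x - u) + l1 (x - u))))) := by
              refine mul_le_mul_of_nonneg_left ?_ (by positivity)
              rw [← Real.exp_add, ← Real.exp_add]
              exact Real.one_le_exp (by nlinarith)
          _ = C * Real.exp (-δ * l1 (u' - u)) * Real.exp (-δ * (l1 (x - u) + l1 (x - u))) := by rw [hC]; ring
      · rw [ctGen_eq_zero_of_not_mem_cube α L κ' u' hx', mul_zero, mul_zero, abs_zero]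
        exact hnn
    · rw [ctGen_eq_zero_of_not_mem_cube α L κ u hx, zero_mul, mul_zero, abs_zero]
      exact hnn
  · rw [abs_zero]; exact hnn

/-- [folklore] The `∃`-form of the two classes for the symbol family `j α κ u κ′ u′ ↦ (c j)·ĝ·ĝ′` (the binders `hhb`/`hhl` of
`SpineRooted.axisReflectionCovariant_flipK_TbalOf_JsRecWAtOf_of_letters_closed` for the canonical second symbol). -/
theorem canon_classes (c : ℕ → ℝ) (j : ℕ) (α' : Fin (d + 1)) :
    (∃ Bh : ℝ, ∀ (κ : Fin (d + 1)) (u : Fin (d + 1) → ℤ) (κ' : Fin (d + 1)) (u' : Fin (d + 1) → ℤ) (p : Fin (d + 1) → ℤ) (a : Fib d),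
        |c j * (ctGen d α' L κ u p a * ctGen d α' L κ' u' p a)| ≤ Bh) ∧
      ∃ Ch mh : ℝ, 0 < mh ∧ LocStencil₂ (fun κ u κ' u' => diagK fun p a => c j * (ctGen d α' L κ u p a * ctGen d α' L κ' u' p a)) Ch mh :=
  ⟨⟨_, abs_ctGen_mul_ctGen_le α' L (c j)⟩, ⟨_, 1, one_pos, locStencil₂_diagK_ctGen_mul_ctGen α' L (c j) zero_le_one⟩⟩

end Canon

end

end Summit.QuantumFields.BalabanUV.Beta.SecondOrderZeroCanon
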